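import Mathlib
import HarnessLib
import HarnessLib.Audit
import Summits.RiemannHypothesis.Statement
import Literature.NumberTheory.LFunctions.ZetaZeros
import HarnessLib.Audit.Status.Attr

/-!
Route: TuranResolution

DORMANT since 2026-08-23T02:15:30Z (reconciler: no traction for 5.8 d (last activity item-evidence-added at 2026-08-17T05:09:42Z); parked, not closed — `ledger route dormant route-RiemannHypothesis-TuranResolution --off` to reactivate) — unstaffed, not closed; items shared with open routes are served there. `ledger route dormant <id> --off` reactivates.

Route TuranResolution — RH height by height from prime power sums: the RESOLUTION LAW of prime data
(idea card card:RiemannHypothesis/RiemannHypothesis/turan-resolution-law).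

THESIS X (words): the HEIGHT-LOCAL TURÁN CRITERION. For t ∈ ℝ and k ≥ 1 put Z_k(t) := (−1)^k
(ζ′/ζ)^(k)(2+it)/k! + (1+it)^−(k+1) − Σ_(m≥0) (4+2m+it)^−(k+1). By the partial-fraction expansion of
ζ′/ζ over the zeros (Levinson–Montgomery (2.1), in tree from the PROVED Hadamard fact) Z_k(t) = Σ_ρ
m(ρ)(2+it−ρ)^−(k+1), the k-th power sum of the non-trivial zeros seen from the vantage point s₀ =
2+it (support ZeroSide); by ζ′/ζ = −Σ Λ(n)n^−s it is the absolutely convergent PRIME SUM −(1/k!)Σ_n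
Λ(n)(log n)^k n^(−2−it) plus two elementary terms (support PrimeSide; the terms peak at log n = k,
so Z_k(t) is data from the primes up to X = e^(k+O(√k))). X says: there is C with |Z_k(t)| ≤
C·(2/3)^k·log(|t|+3) for every real t and every k ≥ 1.

GEOMETRY: the disc |s − s₀| < 3/2 is TANGENT to the critical line at 1/2+it. On RH every zero is at
distance ≥ 3/2 from s₀ and X holds with C from the window bound N(u+1)−N(u) ≪ log(|u|+2) (support
CriterionOfRH). An off-line zero ρ = 1/2+δ+iγ lies at distance ≤ 3/2−δ from 2+iγ, its term beats the
threshold by ((3/2)/(3/2−δ))^k ≈ e^((2/3)δk), and Turán's second main theorem (PROVED in tree) over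
a window of ν+1 consecutive k turns this into a certified violation of X at some k ≲ (1+ν)(log log γ
+ log(1/δ))/δ, ν = local off-line cluster count (cruxes TangentDiscPowerSum → LocalDetection). So X
is RH-STRENGTH (honest: RH ⟺ X will land as two tree theorems); the route's deliverables are the two
halves of the resolution law — DETECTION (prime length (log T)^O((1+ν)/δ) decides offset-δ zeros at
a known height; T^O(1/δ) unconditionally) and BLINDNESS (no type-L linear explicit-formula statistic
sees an offset-δ pair while cosh(Lδ) ≲ L·(counting slack)) — and the pricing of every prime-side
programme on this summit by the one unknown exchange rate ν ('S(t) is the currency').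

X (Lean, one line; elaborated in the planner's Sketch.lean, rc 0; constants: riemannZeta, logDeriv,
iteratedDeriv, Nat.factorial, Complex.I, tsum, Real.log): ∃ C : ℝ, ∀ (t : ℝ) (k : ℕ), 1 ≤ k → ‖(-1 :
ℂ) ^ k * iteratedDeriv k (logDeriv riemannZeta) (2 + t * Complex.I) / (k.factorial : ℂ) + ((1 + t *
Complex.I) ^ (k + 1))⁻¹ - ∑' m : ℕ, ((4 + 2 * (m : ℂ) + t * Complex.I) ^ (k + 1))⁻¹‖ ≤ C * (2 / 3 :
ℝ) ^ k * Real.log (|t| + 3)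

ASSEMBLY: LocalDetection → X → Summit.RiemannHypothesis (Sketch.lean: `example : Assembly =
(LocalDetection → TuranCriterion → _root_.RiemannHypothesis) := rfl`). Two-layer plan (D-0019):
cruxes #2–#4 first, glue (truncation lemmas, explicit constants, the conditional polylog-decision
corollary) only after a crux closes.

UNDER FLOOR: fewer than 2 cruxes remain after retriage (legacy route; D-0019).

Rationale: WHY THIS LINE (card:RiemannHypothesis/RiemannHypothesis/turan-resolution-law). Imports brought to
bear, all PROVED in tree: Turán's power-sum theory
(Literature.Analysis.Complex.PowerSum.exists_powerSum_ge_max), Hadamard partial fractions of ζ′/ζ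
(Literature.NumberTheory.LFunctions.XiProduct.logDeriv_riemannZeta +
Literature.Analysis.Complex.hadamard_genus_zero_holds), zero windows
(Literature.NumberTheory.LFunctions.Montgomery.exists_zetaZeroCount_window_le); plus Paley–Wiener /
nonharmonic Fourier frames (Duffin–Schaeffer, Ortega-Cerdà–Seip math/0005092) for the adversary.
Every programme deciding RH 'height by height' from PRIME data (explicit-formula-bootstrap, Turán /
Maynard–Pratt detectors arXiv:2206.11729, tube and strip-DN cards) trades prime length X = e^L
against offset δ and height T with no stated exchange rate. This route makes the rate a two-sided
theorem. DETECTION: from 2+it the radius-3/2 disc is tangent to the line, an offset-δ zero is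
e^((2/3)δk)-visible in Z_k, and Turán II over ν+1 consecutive k certifies it at k ≲ (1+ν)(log log T
+ log(1/δ))/δ — prime length POLYLOG in T when off-line clusters are bounded, T^O(1/δ)
unconditionally (ν ≤ 0.2 log T, Trudgian2014), T^(o(1)/δ) under Lindelöf (Backlund). BLINDNESS:
type-≤L linear statistics cannot see the pair while cosh(Lδ) ≲ L·slack: the zero sequence is
oversampled ((1/2π)log T ≫ L/π) and an adversary absorbs the pair's signature into ℓ¹-small
displacements along the line. Between the two sits exactly ν ('S(t) is the currency'). Sources:
Turan1984NewMethod, Turan1951Carlson, HalaszTuran1969, HalaszTuran1970, Gallagher1970,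
SoundararajanThorner2019, Pintz2022HalaszTuranDensity, Voros2010, Trudgian2014, Titchmarsh1986
§§2.12, 9.2, 13.5.
RANKED CRUXES. #2 TangentDiscPowerSum — the pure finite power-sum lemma (multisets, no ζ); provable
on Turán II now, refutable by a configuration if the k-range is mis-booked; planner's paper check
(NOTES.md): true with A ≈ 100; NB the card's additive 'log log T + Cν' is too optimistic — Turán's
constant (n/(250(D+n)))^(n+1) forces the multiplicative (1+n)(ℓ+log(1+n)); the polylog consequence
survives as (log T)^O((1+ν)/δ). #3 BandLimitedBlindness — the novel half, filed informal (no
signature) until a grounder/refuter types the PW_L moment problem; exact matching needs infinitely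
many ℓ¹-small displacements (a finitely supported modification never annihilates the Bernstein
space). #4 LocalDetection — ζ-specialisation of #2 (far-zero truncation, zetaZeroCountRe windows,
conjugation, mirrored low zeros); makes X → RH a theorem. Target #0 TuranCriterion (RH-strength).
Support (rank 9, provable now): PrimeSide, ZeroSide, CriterionOfRH. Assembly #1: LocalDetection →
TuranCriterion → Summit.RiemannHypothesis (provable now).
KILL CRITERIA. (i) #2 refuted in SHAPE — no bound (1+n)·poly(ℓ, log(1+n))/δ for tangent-disc power
sums: the detection half and 'polylog-local under isolation' die; close unless a half-isolation
(Maynard–Pratt Lemma 11) restatement survives one repair. (ii) #3 refuted even in ε-form (some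
type-L statistic separates every admissible fake configuration already at Lδ ≍ 1): prime-side
programmes are cheaper than priced — close as superseded by explicit-formula-bootstrap, handing it
the separating functional. (iii) When #2, #4, supports have landed (RH ⟺ X formal) and #3 is
settled, X starves by design: close 'delivered' with the law as census unless
isolation-hypothesis-ioz (ν = O(1)) or a ν-free certificate moves. A certified violation of X at one
(k,t) would be a certified counterexample to RH.
NOT DECOMPOSED YET. No ν-free 'certificate upgrade' item (card's rank-2 question; Bourgain's
example, Maynard–Pratt Rem. 13, says bare power sums cannot; LP duals might); no conditional item
IsolationHypothesis → [RH to height T at offset ≥ δ ⟺ finitely many prime-sum inequalities, k ≤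
K(δ,T)]; no explicit constants; no lattice toy case of #3; no Davenport–Heilbronn control item; no
compute (δ_detect table, least-squares blindness experiment).

Novelty: NOVELTY. Searched 2026-08-15 before claiming: lit search --source zbmath ('Turán power sum method
zeta zeros' → Pintz2022HalaszTuranDensity doi:10.1007/s10474-021-01204-z; 'Halász Turán distribution
of roots of Riemann zeta allied functions' → HalaszTuran1969 doi:10.1016/0022-314x(69)90031-6,
HalaszTuran1970 doi:10.1007/bf01894786; 'Gallagher large sieve density near sigma 1 Turán' →
Gallagher1970 doi:10.1007/bf01403187; 'Voros superzeta' → Voros2010 arXiv:math/0311029; 'Sekatskii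
generalized Li criterion' → doi:10.1007/s11253-014-0940-9; 'Li criterion Bombieri Lagarias' →
doi:10.1006/jnth.1999.2392; 'Soundararajan Thorner weak subconvexity' → arXiv:1804.03654; 0 hits:
'band-limited explicit formula zeros indistinguishable primes', 'RH criterion derivatives
logarithmic derivative zeta at integer point'); lit galaxy search --star all 'power sums over zeros
… Turán second main theorem' (0), --star panama 'second main theorem' (noise), --title-contains 'new
method of analysis' (Turán 1984 not in panama); local searchd index unreachable (ConnectionReset)
all session, openalex 429; lean search: Turán I/II and Hadamard genus-0 PROVED in Literature; card
audit by refuter-novelty-audit-RiemannHypothesis-RiemannHypothesis-9-0 (grade new-combination,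
accepted here).
Nearest prior art: (1) LOCAL ZERO DETECTION from the power sums (ζ′/ζ)^(k)(s₀)/k! =
−Σ(s₀−ρ)^−(k+1)+… at a vantage point right of the line via Turán's second main theorem, window
length = local zero count: Turan1984NewMetho  [refs: 10.1007/s10474-021-01204-z, 10.1016/0022-314x(69, 10.1007/bf01894786, 10.1007/bf01403187, 10.1007/s11253-014-0940-9, 10.1006/jnth.1999.2392, math/0311029, 1804.03654, 2206.11729, doi:10.1007/s10474-021-01204-z, doi:10.1016/0022-314x, doi:10.1007/bf01894786, doi:10.1007/bf01403187, doi:10.1007/s11253-014-0940-9, doi:10.1006/jnth.1999.2392, HalaszTuran1969, HalaszTuran1970, Gallagher1970, Voros2010,]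

Barriers (technique_class: Turan-power-sums; explicit-formula-information; PW-sampling): technique_class: Turan-power-sums; explicit-formula-information; PW-sampling
BARRIERS (a cost law; RH-neutral except the target X).
- Literature.Barriers.RiemannHypothesis.LindelofBacklund (= Titchmarsh1986_thm13_5: size bounds ⇔
o(log T) local off-line counts, never emptiness): USED, not fought — the Turán loss in #2/#4 is an
explicit function of the local count ν that Backlund ties to Lindelöf (LH ⇒ price T^(o(1)/δ);
bounded ν ⇒ polylog); nothing here infers RH or a zero-free region from size.
- Literature.Barriers.RiemannHypothesis.DiamondMontgomeryVorhauer2006_thm1 (BeurlingCounterexamples: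
Landau-type arguments from integer counting stop at 1 − c/log t): consistent and sharpened — #3 is a
height-local blindness statement for band-limited prime-side data of ANY Λ; #2/#4 evade the Beurling
wall only because they consume the EXACT values Λ(n) (a Beurling system has other Λ and other Z_k),
legitimately: the law is about ζ's own data, and no Landau-type argument is claimed to prove X.
- Literature.Barriers.RiemannHypothesis.TuranPartialSums (zeros of the sections ζ_N in σ > 1;
refuted by Montgomery): NOT this Turán idea — named to prevent confusion; the power-sum theorems
used here are PROVED tree theorems (TuranFirstMainTheorem, TuranSecondMainTheorem).
- Literature.Barriers.RiemannHypothesis.DavenportHeilbronn (functional equation without Euler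
product has off-line zeros): respected and usable as CONTROL — the DH function has the same kind of
zero-side power sums and #2 cer

History (route lifecycle, newest last):
- 2026-08-16T04:16:35Z · AUTO-CRUX (backfill): TuranCriterion — hypotheses of the deciding theorem that nothing in the route derives are cruxes (operator:999:1085951)
- 2026-08-23T02:15:30Z · DORMANT — reconciler: no traction for 5.8 d (last activity item-evidence-added at 2026-08-17T05:09:42Z); parked, not closed — `ledger route dormant route-RiemannHypothesi (operator:999:3071514)

sub-problem: RiemannHypothesis · status: dormant · opened planner-plancard-RiemannHypothesis-RiemannHyp-6b12a8bc-0 2026-08-15T11:05:21Z · rev 3 · ledger route-RiemannHypothesis-TuranResolution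
GENERATED by the gate from the ledger (D-0016/17). Provers cite these decls: `theorem foo : Summit.RiemannHypothesis.RiemannHypothesis.Theses.TuranResolution.<Decl> := …` in Summits/RiemannHypothesis/RiemannHypothesis/Theorems/<Name>.lean.
-/

namespace Summit.RiemannHypothesis.RiemannHypothesis.Theses.TuranResolution

open scoped BigOperators Topology Manifold Classical MeasureTheory ProbabilityTheory Matrix InnerProductSpace ComplexConjugate ContinuousMap
open Filter Set Function TopologicalSpace MeasureTheory

attribute [summit_statement] _root_.Summit.RiemannHypothesis

open Summit

/-- item stmt-RiemannHypothesis-2529 · crux (kind.auto-crux: conjecture-grade) · rank 0 · open · by planner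
why it might fail: X ⟺ RH with both directions provable now: RH→X by the unit-window bound (CriterionOfRH); X→RH since |Z_k(t)| ≤ C(2/3)^k·log makes the Taylor series of ξ′/ξ at 2+it converge on the disc tangent to Re s=1/2 (no pole ⇒ no zero with Re ρ>1/2). X fails iff ζ has an off-line zero.
sources: card:RiemannHypothesis/RiemannHypothesis/turan-resolution-law, doi:10.1006/jnth.1999.2392, doi:10.1007/s11253-014-0940-9, Turan1984NewMethod, Titchmarsh1986 §2.12 (2.12.7), Literature.NumberTheory.LFunctions.Montgomery.exists_zetaZeroCount_window_le
[target] X = the height-local Turán criterion: ∃C ∀t ∀k≥1 |Z_k(t)| ≤ C(2/3)^k log(|t|+3), where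
Z_k(t) (inlined ζ-side expression) is the k-th tangent-disc power sum Σ_ρ m(ρ)(2+it−ρ)^−(k+1) of the
non-trivial zeros (support ZeroSide) and is prime-computable (support PrimeSide). RH-strength by
design: RH → X is CriterionOfRH; X → RH is the Assembly via LocalDetection. Each instance (k,t) is a
finite prime-side inequality (primes ≤ e^(k+O(√k)), precision (2/3)^k). -/
@[route_item "route-RiemannHypothesis-TuranResolution", crux]
def TuranCriterion : Prop :=
  ∃ C : ℝ, ∀ (t : ℝ) (k : ℕ), 1 ≤ k → ‖(-1 : ℂ) ^ k * iteratedDeriv k (logDeriv riemannZeta) (2 + t * Complex.I) / (k.factorial : ℂ) + ((1 + t * Complex.I) ^ (k + 1))⁻¹ - ∑' m : ℕ, ((4 + 2 * (m : ℂ) + t * Complex.I) ^ (k + 1))⁻¹‖ ≤ C * (2 / 3 : ℝ) ^ k * Real.log (|t| + 3)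

/-- item stmt-RiemannHypothesis-2531 · support · rank 2 · open · by planner
why it might fail: Refutable as STATED: disc vs rest separate only by (1+δ/3) per step while Turán's constant costs (n+1)log(250(D+n)/n) with D ≍ k; drop the log(1+n) or log(1/δ) terms (the card's additive 'loglog T + Cν' does) and a clustered configuration refutes the k-range; Bourgain's example forbids poly(n) loss.
sources: Literature.Analysis.Complex.PowerSum.exists_powerSum_ge_max (TuranSecondMainTheorem.lean:894, PROVED), Literature.NumberTheory.LFunctions.LogFreeDensity.lemmeA_abstract (LogFreeDensityLemmaA.lean:673, PROVED), Literature.NumberTheory.LFunctions.LogFreeDensity.turanLoss_ge + far_shell_sum_le (PROVED), Bombieri1987GrandCrible §6 Lemme A, Turan1984NewMethod §8, Turan1951Carlson Lemma III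
[crux] THE TANGENT-DISC POWER-SUM LEMMA (pure, finite; no ζ). Vantage s₀, finite multiset Z
('zeros', multiplicity by repetition). If some ρ₀ ∈ Z, ρ₀ ≠ s₀, has |s₀−ρ₀| ≤ 3/2−δ, and for every k
the points OUTSIDE the closed disc of radius 3/2−δ/2 have Σ|s₀−ρ|^−(k+1) ≤ B(3/2−δ/2)^−(k+1), then
some k with 1 ≤ k ≤ A(1+n)(log B + log C + log(1/δ) + log(1+n) + 1)/δ (n = number of points of Z in
the closed disc of radius 3/2−δ/2) has |Σ_{ρ∈Z}(s₀−ρ)^−(k+1)| > C(2/3)^k. Proof plan (planner's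
paper check, NOTES.md; A ≈ 100 works): Turán's second main theorem
(Literature.Analysis.Complex.PowerSum.exists_powerSum_ge_max, PROVED; b ≡ 1, z_ρ = (s₀−ρ)^−1, max
modulus ≥ (3/2−δ)^−1, points equal to s₀ contribute 0) with D+1 = ⌈(48/δ)(1+n)(ℓ+log(1+n))⌉ gives k
∈ [D, D+n−1] with |Σ_disc| ≥ e^−n(n/(250(D+n)))^(n+1)(3/2−δ)^−(k+1); the rest and the threshold are
≤ (B+2C)(3/2−δ/2)^−(k+1); win because (3/2−δ/2)/(3/2−δ) ≥ 1+δ/3 and (k+1)log(1+δ/3) ≥ (k+1)δ/4 ≥ n +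
(n+1)log(250(D+n)/n) + log(B+2C) + log 2 for this D. Reusable by Strip (density items) and
explicit-formula-bootstrap. -/
@[route_item "route-RiemannHypothesis-TuranResolution"]
def TangentDiscPowerSum : Prop :=
  ∃ A : ℝ, ∀ (Z : Multiset ℂ) (s₀ : ℂ) (B C δ : ℝ), 1 ≤ B → 1 ≤ C → 0 < δ → δ ≤ 1 / 2 → (∃ ρ₀ ∈ Z, ρ₀ ≠ s₀ ∧ ‖s₀ - ρ₀‖ ≤ 3 / 2 - δ) → (∀ k : ℕ, ((Z.filter (fun ρ => 3 / 2 - δ / 2 < ‖s₀ - ρ‖)).map (fun ρ => (‖s₀ - ρ‖ ^ (k + 1))⁻¹)).sum ≤ B * ((3 / 2 - δ / 2) ^ (k + 1))⁻¹) → ∃ k : ℕ, 1 ≤ k ∧ (k : ℝ) ≤ A * (1 + (Z.filter (fun ρ => ‖s₀ - ρ‖ ≤ 3 / 2 - δ / 2)).card) * (Real.log B + Real.log C + Real.log (1 / δ) + Real.log (1 + (Z.filter (fun ρ => ‖s₀ - ρ‖ ≤ 3 / 2 - δ / 2)).card) + 1) / δ ∧ C * (2 / 3 : ℝ) ^ k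 < ‖(Z.map (fun ρ => ((s₀ - ρ) ^ (k + 1))⁻¹)).sum‖

-- item stmt-RiemannHypothesis-2614 · support · rank 3 · open · by planner — informal only, no Lean statement yet:
--   [crux] BAND-LIMITED BLINDNESS (the adversary half of the resolution law; informal until a
--   grounder/refuter sets a signature — typing needs the Bernstein space B_L and a class of 'zero-like
--   configurations'). SETTING: write every non-trivial zero as ρ = 1/2 + iγ_ρ (γ_ρ real iff ρ is on the
--   line; an FE-pair 1/2±δ+it₀ is γ = t₀ ∓ iδ) and let m = Σ_ρ m(ρ) δ_{γ_ρ} be the zero measure. A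
--   LINEAR EXPLICIT-FORMULA STATISTIC OF TYPE ≤ L is m ↦ ∫F dm with F entire of exponential type ≤ L,
--   bounded on ℝ (F = ĝ, supp g ⊂ [−L, L]: exactly what the primes p^k ≤ X = e^L determine, up to the
--   absolutely convergen

/-- item stmt-RiemannHypothesis-2532 · support · rank 4 · open · by planner
why it might fail: RH-implied for ζ (vacuous without off-line zeros): fails only as a PROOF target — if #2 must count n over ALL offsets in the tangent disc (offsets in (0,δ/2) are 'medium' terms), the ν-window is too small and becomes ≍ log T, collapsing polylog to T^O(1/δ); low mirrored zeros are traps.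
sources: Literature.NumberTheory.LFunctions.LogFreeDensity.lemmeA_zeta (LogFreeDensityZetaLemmaA.lean:35, PROVED), Literature.NumberTheory.LFunctions.zetaZeroBox_finite / zetaZeroCountRe (ZetaZeros.lean:164–189), Literature.NumberTheory.LFunctions.Montgomery.exists_zetaZeroCount_window_le (PROVED), Literature.Analysis.Complex.PowerSum.exists_powerSum_ge_max (via TangentDiscPowerSum), Bombieri1987GrandCrible §6 Lemme A (χ = χ₀), Turan1984NewMethod Part II
[crux] LOCAL DETECTION FOR ζ (the detection half of the law). ∃A ∀C≥1 ∀δ∈(0,1/2] ∀T≥3 ∀ρ with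
ζ(ρ)=0, Re ρ ≥ 1/2+δ, |Im ρ| ≤ T: ∃k, 1 ≤ k ≤ A(1+ν)(log log T + log C + log(1/δ) + 1)/δ and |Z_k(Im
ρ)| > C(2/3)^k log(T+3), where ν := N(1/2+δ/2, |Im ρ|+2) − N(1/2+δ/2, |Im ρ|−2) (zetaZeroCountRe
window, with multiplicity) and Z_k is the inlined tangent-disc power sum of the target. From #2
TangentDiscPowerSum with Z := zeros with |Im − Im ρ| ≤ 2 (finite, zetaZeroBox_finite), B ≍ log(T+3),
C·c·log(T+3) in place of C (absorbing the far tail Σ_{|γ−t|>2}|s₀−ρ|^−(k+1) ≤ c(2/3)^k log(T+3) from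
Montgomery.exists_zetaZeroCount_window_le, PROVED), log(1+n) ≤ log log T + c; ZeroSide for Z_k =
Σ_ρ; riemannZeta_conj for Im ρ < 0; riemannZeta_neg_of_pos_of_lt_one (no real zeros); a factor 2 for
mirrored zeros when |Im ρ| < 2. CONSEQUENCE (the price list): prime tables of length exp(O((1+ν)(log
log T + log(1/δ))/δ)) = (log T·δ^−1)^O((1+ν)/δ) decide an offset-δ zero at a KNOWN height — polylog
in T under bounded clustering, T^O(1/δ) unconditionally (ν ≤ 0.2 log T), T^(o(1)/δ) under Lindelöf. -/
@[route_item "route-RiemannHypothesis-TuranResolution", crux]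
def LocalDetection : Prop :=
  ∃ A : ℝ, ∀ (C δ T : ℝ) (ρ : ℂ), 1 ≤ C → 0 < δ → δ ≤ 1 / 2 → 3 ≤ T → riemannZeta ρ = 0 → 1 / 2 + δ ≤ ρ.re → |ρ.im| ≤ T → ∃ k : ℕ, 1 ≤ k ∧ (k : ℝ) ≤ A * (1 + ((Literature.NumberTheory.LFunctions.zetaZeroCountRe (1 / 2 + δ / 2) (|ρ.im| + 2) : ℝ) - Literature.NumberTheory.LFunctions.zetaZeroCountRe (1 / 2 + δ / 2) (|ρ.im| - 2))) * (Real.log (Real.log T) + Real.log C + Real.log (1 / δ) + 1) / δ ∧ C * (2 / 3 : ℝ) ^ k * Real.log (T + 3) < ‖(-1 : ℂ) ^ k * iteratedDeriv k (logDeriv riemannZeta) (2 + ρ.im * Complex.I) / (k.factorial : ℂ) + ((1 + ρ.im * Complex.I) ^ (k + 1))⁻¹ - ∑' m : ℕ, ((4 + 2 * (m : ℂ) + ρ.im * Complex.I) ^ (k + 1))⁻¹‖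

/-- item stmt-RiemannHypothesis-2533 · support · rank 9 · open · by planner
sources: Mathlib LSeries_iteratedDeriv, Mathlib LSeries_vonMangoldt_eq_deriv_riemannZeta_div, Literature.NumberTheory.LFunctions.logDeriv_riemannZeta_eq_div
[support] provable now (Mathlib): (−1)^k · iteratedDeriv k (logDeriv ζ)(2+it) = −LSeries(n ↦
Λ(n)(log n)^k)(2+it) for all t, k. logDeriv ζ = deriv ζ/ζ = −L(Λ) on the open half-plane Re s > 1
(LSeries_vonMangoldt_eq_deriv_riemannZeta_div; tree: logDeriv_riemannZeta_eq_div), iterated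
derivatives of eventually-equal functions agree at 2+it, and LSeries_iteratedDeriv (abscissa of Λ ≤
1 < 2): iteratedDeriv k (L Λ) = (−1)^k L(log^k·Λ). Makes Z_k(t) computable from Λ(n): the terms
Λ(n)(log n)^k n^−2 peak at log n = k with width √k, so primes up to X = e^(k+O(√k)) carry Z_k to
precision e^−ck. -/
@[route_item "route-RiemannHypothesis-TuranResolution"]
def PrimeSide : Prop :=
  ∀ (t : ℝ) (k : ℕ), (-1 : ℂ) ^ k * iteratedDeriv k (logDeriv riemannZeta) (2 + t * Complex.I) = - LSeries (fun n : ℕ => ((ArithmeticFunction.vonMangoldt n : ℝ) : ℂ) * ((Real.log n : ℝ) : ℂ) ^ k) (2 + t * Complex.I)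

/-- item stmt-RiemannHypothesis-2534 · support · rank 9 · open · by planner
sources: Literature.NumberTheory.LFunctions.XiProduct.logDeriv_riemannZeta, Literature.Analysis.Complex.hadamard_genus_zero_holds, Titchmarsh1986 §2.12 (2.12.7), LevinsonMontgomery1974 (2.1), Voros2010
[support] provable now from the PROVED cone: for k ≥ 1 and real t, HasSum over the non-trivial zeros
ρ (ZetaZeros.riemannZetaNontrivialZeros, weight riemannZetaZeroOrder ρ) of m(ρ)(2+it−ρ)^−(k+1), with
sum Z_k(t) = (−1)^k(ζ′/ζ)^(k)(2+it)/k! + (1+it)^−(k+1) − Σ_{m≥0}(4+2m+it)^−(k+1). From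
Literature.NumberTheory.LFunctions.XiProduct.logDeriv_riemannZeta (Levinson–Montgomery (2.1) =
Titchmarsh (2.12.7): ζ′/ζ(s) = Σₙ ½(T(bₙ,s)+T(b̄ₙ,s)) − 1/(s−1) + ½log π − ½ψ(s/2+1), data
XiProduct.ofHadamard hadamard_genus_zero_holds; multiplicities via hadamard_genus_zero_zeros /
XiProduct.zero_of_ne_zero): differentiate the locally uniformly convergent series k ≥ 1 times
(constants die; d^k/ds^k 1/(s−ρ) = (−1)^k k!/(s−ρ)^(k+1)), ψ^(k)(z) = (−1)^(k+1) k!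
Σ_{j≥0}(z+j)^−(k+1) for the Γ-term giving the trivial-zero sum Σ_{m≥0}(s+2+2m)^−(k+1), and re-index
the XiProduct terms by zeros with multiplicity (absolute convergence for k ≥ 1 from Σ 1/|ρ|² < ∞). -/
@[route_item "route-RiemannHypothesis-TuranResolution"]
def ZeroSide : Prop :=
  ∀ (t : ℝ) (k : ℕ), 1 ≤ k → HasSum (fun ρ : Literature.NumberTheory.LFunctions.ZetaZeros.riemannZetaNontrivialZeros => (Literature.NumberTheory.LFunctions.riemannZetaZeroOrder (ρ : ℂ) : ℂ) * ((2 + t * Complex.I - (ρ : ℂ)) ^ (k + 1))⁻¹) ((-1 : ℂ) ^ k * iteratedDeriv k (logDeriv riemannZeta) (2 + t * Complex.I) / (k.factorial : ℂ) + ((1 + t * Complex.I) ^ (k + 1))⁻¹ - ∑' m : ℕ, ((4 + 2 * (m : ℂ) + t * Complex.I) ^ (k + 1))⁻¹)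

/-- item stmt-RiemannHypothesis-2535 · support · rank 9 · open · by planner
sources: Literature.NumberTheory.LFunctions.Montgomery.exists_zetaZeroCount_window_le, Titchmarsh1986 Thm 9.2, Trudgian2014
[support] provable now: RH → X (calibration; makes X exactly RH-strength and fixes the threshold the
detector must beat). On RH every zero ρ = 1/2+iγ has |2+it−ρ|² = 9/4+(t−γ)² ≥ 9/4, so by ZeroSide
|Z_k(t)| ≤ Σ_ρ m(ρ)(9/4+(t−γ)²)^−(k+1)/2 ≤ (2/3)^(k−1) Σ_ρ m(ρ)/(9/4+(t−γ)²) ≤ C(2/3)^k log(|t|+3),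
the last step from the window bound N(u+1)−N(u) ≤ C₀ log(|u|+2)
(Literature.NumberTheory.LFunctions.Montgomery.exists_zetaZeroCount_window_le, PROVED) summed over
unit windows with weights 1/(9/4+(|j|−1)₊²). An explicit C (from an explicit C₀, e.g. Trudgian2014)
turns each instance (k,t) of X into a finite certificate; not needed for the assembly. -/
@[route_item "route-RiemannHypothesis-TuranResolution"]
def CriterionOfRH : Prop :=
  Summit.RiemannHypothesis → TuranCriterion

/-- item stmt-RiemannHypothesis-2530 · assembly · rank 1 · open · by planner
sources: Sketch.lean (planner folder), Mathlib riemannZeta_one_sub, riemannZeta_ne_zero_of_one_le_re, Literature.NumberTheory.LFunctions.quasiRiemannHypothesis_one_half_iff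
[assembly] LocalDetection → TuranCriterion → Summit.RiemannHypothesis. Proof (provable now): let
ζ(s)=0, s non-trivial, s ≠ 1, Re s ≠ 1/2. Re s ≥ 1 is impossible (riemannZeta_ne_zero_of_one_le_re);
Re s ≤ 0 forces a trivial zero (riemannZeta_one_sub / Mathlib's classification, as in the tree's
riemannHypothesis_iff-type lemmas); if Re s < 1/2 replace s by 1−s (riemannZeta_one_sub: Γ and cos
factors finite and non-zero in the strip). So ρ with Re ρ = 1/2+δ, δ ∈ (0,1/2). Apply LocalDetection
with C' := max C 1, T := max 3 |Im ρ|: some k ≥ 1 has C'(2/3)^k log(T+3) < |Z_k(Im ρ)| ≤ C(2/3)^k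
log(|Im ρ|+3) ≤ C'(2/3)^k log(T+3) — contradiction. Shape checked in Sketch.lean: `example :
Assembly = (LocalDetection → TuranCriterion → _root_.RiemannHypothesis) := rfl`. -/
@[route_item "route-RiemannHypothesis-TuranResolution"]
def Assembly : Prop :=
  LocalDetection → TuranCriterion → Summit.RiemannHypothesis

/-! D-0027 §2.1 — DECIDING THEOREM (planner-authored via `route open/edit --closes-file`; by planner-rbadge-RiemannHypothesis-TuranResoluti-d42d6271-g2-0 2026-08-15T16:19:35Z):
its hypotheses are this route's items and its conclusion the sub-problem Statement (glue_lint), and it elaborates with this file. -/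

@[closes "route-RiemannHypothesis-TuranResolution"] theorem closes (h₁ : LocalDetection) (h₂ : TuranCriterion) : _root_.Summit.RiemannHypothesis := by
  -- Step A (detection vs. criterion): `ζ` has no zero with `1/2 < Re s`.
  have key : ∀ s : ℂ, riemannZeta s = 0 → 1 / 2 < s.re → False := by
    intro s hs hgt
    have hlt : s.re < 1 := by
      by_contra h
      exact riemannZeta_ne_zero_of_one_le_re (not_lt.1 h) hs
    obtain ⟨C, hC⟩ := h₂
    obtain ⟨A, hA⟩ := h₁
    obtain ⟨k, hk1, -, hk⟩ := hA (max C 1) (s.re - 1 / 2) (max 3 |s.im|) s (le_max_right _ _)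
      (by linarith) (by linarith) (le_max_left _ _) hs (by linarith) (le_max_right _ _)
    have hb := hC s.im k hk1
    have hlog0 : 0 ≤ Real.log (|s.im| + 3) := Real.log_nonneg (by linarith [abs_nonneg s.im])
    have hlog1 : Real.log (|s.im| + 3) ≤ Real.log (max 3 |s.im| + 3) :=
      Real.log_le_log (by linarith [abs_nonneg s.im]) (by linarith [le_max_right 3 |s.im|])
    have h23 : (0 : ℝ) ≤ (2 / 3 : ℝ) ^ k := by positivity
    have hC1 : (0 : ℝ) ≤ max C 1 := le_trans zero_le_one (le_max_right _ _)
    have step1 : C * (2 / 3 : ℝ) ^ k * Real.log (|s.im| + 3) ≤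
        max C 1 * (2 / 3 : ℝ) ^ k * Real.log (|s.im| + 3) :=
      mul_le_mul_of_nonneg_right (mul_le_mul_of_nonneg_right (le_max_left C 1) h23) hlog0
    have step2 : max C 1 * (2 / 3 : ℝ) ^ k * Real.log (|s.im| + 3) ≤
        max C 1 * (2 / 3 : ℝ) ^ k * Real.log (max 3 |s.im| + 3) :=
      mul_le_mul_of_nonneg_left hlog1 (mul_nonneg hC1 h23)
    linarith
  -- Step B: Mathlib's `RiemannHypothesis` from `key` via the functional equation `s ↦ 1 - s`.
  intro s hs hnt h1
  rcases lt_trichotomy s.re (1 / 2) with hlt | heq | hgt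
  · exfalso
    have hs0 : s ≠ 0 := by
      rintro rfl
      rw [riemannZeta_zero] at hs
      norm_num at hs
    set u : ℂ := 1 - s with hu
    have hsu : s = 1 - u := by simp [hu]
    have hure : 1 / 2 < u.re := by simp [hu]; linarith
    have hu1 : u ≠ 1 := fun h ↦ hs0 (by simp [hsu, h])
    have hun : ∀ n : ℕ, u ≠ -n := by
      intro n hn
      have := congrArg Complex.re hn
      simp at this
      linarith [n.cast_nonneg (α := ℝ)]
    have hfe := riemannZeta_one_sub hun hu1
    rw [← hsu, hs] at hfe
    have hΓ : Complex.Gamma u ≠ 0 := Complex.Gamma_ne_zero_of_re_pos (by linarith)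
    have hπ : (Real.pi : ℂ) ≠ 0 := by exact_mod_cast Real.pi_ne_zero
    have hpow : (2 * (Real.pi : ℂ)) ^ (-u) ≠ 0 := by
      rw [Ne, Complex.cpow_eq_zero_iff, not_and_or]
      exact Or.inl (by simp [hπ])
    by_cases hζu : riemannZeta u = 0
    · exact key u hζu hure
    · have hcos : Complex.cos (Real.pi * u / 2) = 0 := by
        have : 2 * (2 * (Real.pi : ℂ)) ^ (-u) * Complex.Gamma u * Complex.cos (Real.pi * u / 2) *
            riemannZeta u = 0 := hfe.symm
        simpa [hζu, hΓ, hpow] using this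
      obtain ⟨k, hk⟩ := Complex.cos_eq_zero_iff.1 hcos
      have huk : u = 2 * k + 1 := by
        have := mul_right_cancel₀ hπ
          (by linear_combination 2 * hk : u * Real.pi = (2 * k + 1) * Real.pi)
        simpa using this
      have hsk : s = -2 * k := by rw [hsu, huk]; ring
      have hk0 : 0 ≤ k := by
        have h' := congrArg Complex.re huk
        simp at h'
        have h'' : (-1 : ℝ) < (k : ℝ) := by linarith
        exact_mod_cast (Int.lt_iff_add_one_le).1 (by exact_mod_cast h'' : (-1 : ℤ) < k)
      have hk1 : k ≠ 0 := by
        rintro rfl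
        exact hs0 (by simpa using hsk)
      obtain ⟨n, rfl⟩ : ∃ n : ℕ, k = n + 1 := ⟨(k - 1).toNat, by omega⟩
      exact hnt ⟨n, by rw [hsk]; push_cast; ring⟩
  · exact heq
  · exact (key s hs hgt).elim

end Summit.RiemannHypothesis.RiemannHypothesis.Theses.TuranResolution
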